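import Mathlib.Algebra.BigOperators.Fin
import Mathlib.Algebra.Ring.Basic
import Mathlib.Tactic.Ring
import Mathlib.Tactic.LinearCombination
import HarnessLib

/-!
# X3, the DEGENERATE rows OFF the sub-locus, HIGHER LAYERS: POWERS of an algebraic integer from a
# REDUCTION TABLE — `θ^m = Σ_k ν_{m,k} θ^k` for all `m ≤ M` from the single relation
# `θ^{n+1} = Σ_k c_k θ^k` and an INTEGER recurrence on the table `ν` that a display checks by `decide`;
# hence the multiplication table `θ^i θ^j = Σ_k ν_{i+j,k} θ^k` wanted by
# `KummerLayerClasses.exists_cubeRoot_smul_eq_self_of_decomp_table` (cell `bsd-eis`, seat `bsd-eis-x3`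
# gen 8; x3-MEMO-10 §5 (c)/(d); route K1 `AdditiveBranchIMC`, crux `GordTwoRankZeroOffCaseOne` —
# supports only)

HONEST FRAMING (`run/shared/lean/pub/bsd-eis/README.md` §4): THEOREMS ONLY (no `def`, no named fact,
no `sorry`); nothing is booked; no label, tier or count of record moves.

* `pow_eq_table_sum` — `θ ∈ A` (commutative ring), `θ^{n+1} = Σ_{k ≤ n} c_k θ^k`, `ν : ℕ → Fin (n+1) → ℤ`
  with `ν_{m,k} = δ_{mk}` for `m ≤ n` and, for `n ≤ m < M`,
  `ν_{m+1,k} = ν_{m,k−1} [k ≥ 1] + ν_{m,n}·c_k`: then `θ^m = Σ_k ν_{m,k} θ^k` for every `m ≤ M`;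
* `pow_mul_pow_eq_table_sum` — hence `θ^i θ^j = Σ_k ν_{i+j,k} θ^k` for `i, j ≤ n` when `2n ≤ M`.
References: [Cohen1993GTM138] §4.2 (representation of elements of `ℤ[θ]`; method).
-/

set_option autoImplicit false

namespace Summit.BirchSwinnertonDyer.Rank1Residual.Additive

namespace KummerLayerClasses

open Finset

/-- **Powers from a reduction table.** See the module docstring. [folklore] -/
theorem pow_eq_table_sum {A : Type*} [CommRing A] {n : ℕ} (θ : A) (c : Fin (n + 1) → ℤ)
    (hθ : θ ^ (n + 1) = ∑ k : Fin (n + 1), (c k : A) * θ ^ (k : ℕ))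
    (ν : ℕ → Fin (n + 1) → ℤ) (M : ℕ)
    (hν0 : ∀ m : Fin (n + 1), ∀ k : Fin (n + 1), ν m k = if m = k then 1 else 0)
    (hνs : ∀ m : ℕ, n ≤ m → m < M → ∀ k : Fin (n + 1),
      ν (m + 1) k = (if (k : ℕ) = 0 then 0 else ν m ⟨(k : ℕ) - 1, lt_of_le_of_lt (Nat.sub_le _ _) k.2⟩) +
        ν m ⟨n, Nat.lt_succ_self n⟩ * c k) :
    ∀ m : ℕ, m ≤ M → θ ^ m = ∑ k : Fin (n + 1), (ν m k : A) * θ ^ (k : ℕ) := by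
  intro m
  induction m with
  | zero =>
    intro _
    have h := hν0 ⟨0, Nat.succ_pos n⟩
    simp only [Fin.mk_zero] at h
    rw [Finset.sum_eq_single (0 : Fin (n + 1))]
    · rw [h 0]; simp
    · intro k _ hk
      rw [h k, if_neg (Ne.symm hk)]; simp
    · intro h0; exact absurd (Finset.mem_univ _) h0
  | succ m ih =>
    intro hm
    by_cases hmn : m + 1 ≤ n
    · -- still in the basis range: `ν_{m+1} = δ_{m+1}`
      have h := hν0 ⟨m + 1, Nat.lt_succ_of_le hmn⟩
      rw [Finset.sum_eq_single (⟨m + 1, Nat.lt_succ_of_le hmn⟩ : Fin (n + 1))]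
      · rw [h]; simp
      · intro k _ hk
        rw [h k, if_neg (Ne.symm hk)]; simp
      · intro h0; exact absurd (Finset.mem_univ _) h0
    · -- the recurrence step
      push Not at hmn
      have hnm : n ≤ m := by omega
      have hrec := hνs m hnm (by omega)
      have ihm := ih (by omega)
      -- `θ^{m+1} = θ · Σ ν_{m,k} θ^k`, split off the top term `k = n`
      rw [pow_succ, ihm, Finset.sum_mul, Fin.sum_univ_castSucc, Fin.sum_univ_succ]
      -- right-hand side: `ν_{m+1,0}` and `ν_{m+1,k+1} = ν_{m,k} + ν_{m,n} c_{k+1}`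
      have h0 : (ν (m + 1) 0 : A) = (ν m ⟨n, Nat.lt_succ_self n⟩ : A) * (c 0 : A) := by
        have := hrec 0
        simp only [Fin.val_zero, if_true, zero_add] at this
        rw [this]; push_cast; ring
      have hs : ∀ i : Fin n, (ν (m + 1) i.succ : A) =
          (ν m i.castSucc : A) + (ν m ⟨n, Nat.lt_succ_self n⟩ : A) * (c i.succ : A) := by
        intro i
        have := hrec i.succ
        have hne : ((i.succ : Fin (n + 1)) : ℕ) ≠ 0 := by simp [Fin.val_succ]
        rw [if_neg hne] at this
        have hcast : (⟨((i.succ : Fin (n + 1)) : ℕ) - 1, lt_of_le_of_lt (Nat.sub_le _ _) i.succ.2⟩ :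
            Fin (n + 1)) = i.castSucc := by
          ext; simp [Fin.val_succ]
        rw [hcast] at this
        rw [this]; push_cast; ring
      have hlast : (Fin.last n : Fin (n + 1)) = ⟨n, Nat.lt_succ_self n⟩ := rfl
      rw [h0]
      simp_rw [hs]
      -- the top term: `ν_{m,n} θ^n · θ = ν_{m,n} θ^{n+1} = ν_{m,n} Σ c_k θ^k`
      have htop : (ν m (Fin.last n) : A) * θ ^ ((Fin.last n : Fin (n + 1)) : ℕ) * θ =
          (ν m ⟨n, Nat.lt_succ_self n⟩ : A) * ∑ k : Fin (n + 1), (c k : A) * θ ^ (k : ℕ) := by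
        rw [hlast, ← hθ, Fin.val_mk, mul_assoc, ← pow_succ]
      rw [htop, Fin.sum_univ_succ (fun k : Fin (n + 1) ↦ (c k : A) * θ ^ (k : ℕ)), mul_add,
        Finset.mul_sum]
      simp only [Fin.val_zero, pow_zero, mul_one, Fin.val_succ, Fin.val_castSucc]
      have hmid : ∑ i : Fin n, (ν m i.castSucc : A) * θ ^ (i : ℕ) * θ =
          ∑ i : Fin n, (ν m i.castSucc : A) * θ ^ ((i : ℕ) + 1) :=
        Finset.sum_congr rfl fun i _ ↦ by ring
      rw [hmid, add_comm]
      rw [show (∑ i : Fin n, ((ν m i.castSucc : A) + (ν m ⟨n, Nat.lt_succ_self n⟩ : A) * (c i.succ : A)) *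
            θ ^ ((i : ℕ) + 1)) =
          (∑ i : Fin n, (ν m i.castSucc : A) * θ ^ ((i : ℕ) + 1)) +
            ∑ i : Fin n, (ν m ⟨n, Nat.lt_succ_self n⟩ : A) * ((c i.succ : A) * θ ^ ((i : ℕ) + 1)) by
        rw [← Finset.sum_add_distrib]
        exact Finset.sum_congr rfl fun i _ ↦ by ring]
      ring

/-- **The multiplication table from the reduction table**: `θ^i θ^j = Σ_k ν_{i+j,k} θ^k` for
`i, j ≤ n`, given `pow_eq_table_sum` up to `M ≥ 2n`. [folklore] -/
theorem pow_mul_pow_eq_table_sum {A : Type*} [CommRing A] {n : ℕ} (θ : A) (c : Fin (n + 1) → ℤ)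
    (hθ : θ ^ (n + 1) = ∑ k : Fin (n + 1), (c k : A) * θ ^ (k : ℕ))
    (ν : ℕ → Fin (n + 1) → ℤ) (M : ℕ) (hM : 2 * n ≤ M)
    (hν0 : ∀ m : Fin (n + 1), ∀ k : Fin (n + 1), ν m k = if m = k then 1 else 0)
    (hνs : ∀ m : ℕ, n ≤ m → m < M → ∀ k : Fin (n + 1),
      ν (m + 1) k = (if (k : ℕ) = 0 then 0 else ν m ⟨(k : ℕ) - 1, lt_of_le_of_lt (Nat.sub_le _ _) k.2⟩) +
        ν m ⟨n, Nat.lt_succ_self n⟩ * c k)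
    (i j : Fin (n + 1)) :
    θ ^ (i : ℕ) * θ ^ (j : ℕ) = ∑ k : Fin (n + 1), (ν ((i : ℕ) + (j : ℕ)) k : A) * θ ^ (k : ℕ) := by
  rw [← pow_add]
  exact pow_eq_table_sum θ c hθ ν M hν0 hνs _ (by omega)

end KummerLayerClasses

end Summit.BirchSwinnertonDyer.Rank1Residual.Additive
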